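import Literature.MathematicalPhysics.QuantumFieldTheory.Balaban1983to89.B9Ineq349DPDsYOfEBlock
import Literature.MathematicalPhysics.QuantumFieldTheory.Balaban1983to89.B9GeoInputsMultiRateKLevelV1
import Literature.MathematicalPhysics.QuantumFieldTheory.Balaban1983to89.B9Cor36GCubeLocDefectAtLocCfg

/-!
# `Balaban1983to89.B9Eq3105FamTwoAtMember` — FAMILY 2 OF [B9] (3.105) AS AN ∃-THRESHOLD PACKAGE AT THE MEMBER: p33's Z2-P record
# `B9Ineq349DPDsYOfEBlock.hasMajorant_sum_famTwo_zetaY_closed` with its member geometry inputs ([4] Lemma 2.1 (2.61) twice, the four scale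
# transfers) and its fourteen rate binders DISCHARGED above one threshold on `M = L·M_h`, kernel `Θ₂·e^{−κ₂M_h}·e^{−ρ₂d}` with `ρ₂, κ₂, Θ₂`
# MEMBER-INDEPENDENT (sub-row G-B8-T2S ∕ G-B9-LETTERS, the bond-sector member ASSEMBLER, file P2; seat p33 gen 105)

T. Bałaban, *Propagators for lattice gauge theories in a background field*, Commun. Math. Phys. **99** (1985) 389–434
[`Balaban1985BackgroundPropagators`, "B9"]; [4] = T. Bałaban, *Propagators and renormalization transformations for lattice gauge theories. II*,
Commun. Math. Phys. **96** (1984) 223–250 [`Balaban1984PropagatorsII`].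

statement-level skeleton of published theorems with citation tags; proofs where landed; nothing here is a claim about the
Yang–Mills mass gap

THE PRINTED LOCUS (held `paper:balaban1985-cmp99-background-propagators`, journal page = PDF page + 388).  p. 414 (3.105)–(3.106) «Δ_aG₀ = I − … −
Σ_□(1 − ζ_□̃)DPD*h_□G_□h_□ − … = I − R», «R satisfies the bound (3.85) with O(M⁻¹) instead of O(α₁). For M sufficiently large this implies G = G₀(I − R)⁻¹»;
p. 415 l. 22–24 (the second sum of (3.105)) «The term in the second sum gives rise to small terms in the expansion because of the overall exponential factor
and the fact that localizations introduced by 1 − ζ_□̃ and h_□ are separated by a distance ≧ M.»; p. 411 l. 36–41 (the model sentence, written for the first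
sum of (3.95)) «The characteristic function 1 − □̃ at the beginning of the term, and the function h_□ at the end, restrict a kernel of the term to points separated
at least by a distance MLʲη (if □ ∈ 𝒟_j). Hence the part of the exponential factor can be estimated by e^{−(1∕4)δ₀M}»; [4] Lemma 2.1 (2.60)–(2.61) p. 234.

WHY THIS FILE (cell `lit-balaban`; the bond-sector MEMBER ASSEMBLER of the torus [B8] Thm 2 cover form — target signature = the displayed hypothesis of t2s-1's
`B8Thm2TorusCoverOfDeltaAAssembler.hThm2Cover_of_prop6_deltaAAssembler`; scope memo `run/shared/lean/pub/lit-balaban/lit-balaban-p33/g105/ASSEMBLER-SCOPE.md`).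
The four (3.105) families enter M5.7's endpoint `B9Thm310DeltaAIsUnitOfExpansion.eBlock_kernelFamilyBInv_GAY_of_localInverseCubes''` through ONE majorant
`hrest` at ONE rate whose constant must be SMALL above a member threshold.  Family 2 is closed at the ζ of record by p33's Z2-P record, which still displays the
member's (2.61) inequalities, four scale transfers and fourteen rate letters with their budget inequalities, and carries the small factor as `e^{−a_sep·δ·D_sep}`.
THIS FILE fixes all rate letters as explicit functions of the three block rates `δ_G, δ_X, δ_O` (of `G′`, `(Q′G′²Q′*)⁻¹`, the cube letters `O_□`), supplies the
geometry from p21∕p33's threshold packages (`ineq261_three_geo9K`, `scaleTransfer_len_geo9K`, `scaleTransfer_len_sq_geo9K`, `scaleTransfer_len_inv4_geo9K`),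
and rewrites `D_sep = M_h∕(2L)` (§1), so that family 2 becomes an ∃-THRESHOLD PACKAGE of the shape of the family-4 ∕ defect packages
(`B9Cor36GCubeFamFourAtLocCfg.sum_conj_famFour_at_locCfg'`, `B9Cor36GCubeLocDefectAtLocCfg.sum_conj_locDefect_at_locCfg'`): member-independent
`ρ₂, κ₂ > 0`, `Θ₂ ≥ 0` and a threshold `M₀`, and for every member with `M₀ ≤ L·M_h` the family-2 sum `≺ Θ₂·e^{−κ₂M_h}·e^{−ρ₂d}` modulo ONLY the three letters'
blocks (`hE`, `hEO`, `hCinv`), the bi-contractive transporters and `η = |c_f|⁻¹` — exactly what the assembler has at the matrix fibre (p33 FILE 9, p21 FILE 10-D,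
p38 `eBlock_locLetterBY''`).

WHAT THIS FILE PROVES (theorems only; 0 `def`, 0 `def … : Prop`, 0 sorry; standard axioms).
* §1 `exp_DsepT_eq` — `e^{−a·δ·D_sep} = e^{−(aδ∕(2L))·M_h}`, `geo9K_M_eq` — `M = L·M_h` (bookkeeping; twins of `B9Thm39CinvAtCoverLarge.DsepT_eq_div`, `B9Thm37GpAtCoverLarge.geo9K_M_eq'`, which live outside this import cone).
* §2 ★★★ `famTwo_at_member` — the ∃-threshold package described above (rates: `δ_P = min δ_G δ_X`, `δ₀ = δ_P`, `α = β = ¼`, `ρ_P = δ_P∕4`, `Λ = L⁴`;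
  `r = ρ_P∕δ_O`, `ρ = min (r∕3) ½`, `a_sep = α_st = r∕3`, `Λ′ = L²`; `κ₂ = ρ_P∕(6L)`, `ρ₂ = ρ·δ_O`).

HONEST SCOPE.  Pure ∃-bookkeeping over landed theorems; no estimate is added.  DISPLAYED (as in the record): the (3.42) block of `G′` (`hE`), the cube letters'
blocks (`hEO`), the (3.48) block majorant of `(Q′G′²Q′*)⁻¹` (`hCinv`), bi-contractive averaging transporters, `η = |c_f|⁻¹`, the section `ιB`.  NOT here: the
knit into `hrest` (file ASM1), the smallness threshold (file ASM2), families 3–4, the defect family.  Count-neutral; no summit ∕ node statement proved; nothing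
continuum ∕ OS ∕ mass gap ∕ Clay; YM mass gap NOT proved (Track A conditional rung).  `--supports stmt-QuantumFields-19200`.  Net new unproved facts: 0.

RELATED IN THE TREE, NOT DUPLICATED (searched 2026-08-29: `lean search 'famTwo_at_member|FamTwoAtMember' --decl` = ∅): the record `B9Ineq349DPDsYOfEBlock`, the
geometry packages `B9GeoInputsMultiRateKLevelV1`, `B9Cor36GCubeLocDefectAtLocCfg.scaleTransfer_len_geo9K` — USED BY NAME; `B9Thm39CinvAtCoverLarge.DsepT_eq_div` ∕ `B9Thm37GpAtCoverLarge.geo9K_M_eq'` (other import cones) re-derived in three lines each.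

v1.1 (p33 gen 106, 2026-08-29; DOC-ONLY, declarations byte-identical): the line-range locator «p. 411 l. 8–13» corrected to «p. 411 l. 36–41» (×3: the
printed locus above, `exp_DsepT_eq`, `famTwo_at_member`; p. 411 l. 8–13 is the (3.95)–(3.96) display block), and the merged paraphrase formerly placed in
guillemets in the printed locus (a ζ∕h_□ sentence of ours, not print) replaced by the two printed sentences it had merged — p. 415 l. 22–24
(the second sum of (3.105), cut-offs `1 − ζ_□̃`, `h_□`) and p. 411 l. 36–41 (cut-offs `1 − □̃`, `h_□`) — both re-read on the text layer of the held
`paper:balaban1985-cmp99-background-propagators` (PDF pp. 27, 23); [B9] page desk r06 g71 pre-filing note of 2026-08-29T09:08:42Z.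
-/

noncomputable section

open scoped BigOperators

namespace Literature.MathematicalPhysics.QuantumFieldTheory.Balaban1983to89.B9Eq3105FamTwoAtMember

open B6RandomWalk (HasMajorant hasMajorant_mono Ineq261 c1_nonneg)
open B9FromB6 (EBlock)
open B9Thm34Ext (toB6)
open B9Ineq347 (ScaleTransfer)
open B9Eq352DivFormLetters (conj)
open B9Ineq368PPrime (kappa349)
open B9Ineq368PPrimeDs (kappa349_nonneg)
open B6KLevelCensusIndexV1 (KIdx kGeo)
open B6Cover236MultiLevelBlocks (cubes)
open B6GlobalChartV1 (blkV1)
open B6Ineq2142KLevelV1 (β)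
open B9GeoNormsKLevelV1 (geo9K)
open B9GeoLemma21KLevelV1 (geo9K_len_pos one_le_Mh)
open B9GeoInputsMultiRateKLevelV1 (ineq261_three_geo9K scaleTransfer_len_sq_geo9K scaleTransfer_len_inv4_geo9K)
open B9Cor36GCubeLocDefectAtLocCfg (scaleTransfer_len_geo9K)
open B9RWSums347DefiniteFaces (exp261)
open B9RWSums347DefiniteFacesWindow (scaleTransfer_mono_const)
open B9Thm39CinvAtCover (DsepT)
open B9Thm37CubeCoverCommutators (cutMulY hTY)
open B9Eq3104CutoffCommutators (hBdY DPDsY)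
open B9Eq3105ZetaY (zetaY)
open B9Ineq349DPDsYOfEBlock (hasMajorant_sum_famTwo_zetaY_closed)
open B9CubeLettersInvReadings (kernelFamilySInv kernelFamilyBInv)
open Node00 (SiteY BlkY IBondY FBondY CfgY SiteOpY BondOpY SiteParY BondParY toKT etaS XinvY)

variable {d ℓ : ℕ} {hd : 1 ≤ d + 1} {hL : Odd (ℓ + 1) ∧ 1 < ℓ + 1} {b₀ b₁ : ℝ}
variable {𝔸 : Type} [NormedRing 𝔸] [NormedAlgebra ℂ 𝔸] [CompleteSpace 𝔸]
variable {ι : Type} [Fintype ι]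

/-! ## §1 The separation factor in terms of `M_h` -/

/-- `e^{−a·δ·D_sep} = e^{−(aδ∕(2L))·M_h}`: `D_sep = M∕(2L²)` with `M = L·M_h` (p. 411 «points separated at least by a distance MLʲη»).
[cite: Balaban1985BackgroundPropagators, p.411 l.36–41, bookkeeping] -/
theorem exp_DsepT_eq (i : KIdx d ℓ hd hL b₀ b₁) (a δ : ℝ) :
    Real.exp (-(a * δ * DsepT i)) = Real.exp (-(a * δ / (2 * ((ℓ : ℝ) + 1)) * ((toKT i).Mh : ℝ))) := by
  have hL : (0 : ℝ) < (ℓ : ℝ) + 1 := by positivity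
  congr 1
  show -(a * δ * (1 / (2 * ((ℓ : ℝ) + 1) ^ 2) * (((ℓ : ℝ) + 1) * (i.Mh : ℝ)))) = -(a * δ / (2 * ((ℓ : ℝ) + 1)) * ((i.Mh : ℕ) : ℝ))
  field_simp

/-- `M = L·M_h` in `geo9K`'s units. [cite: Balaban1985BackgroundPropagators, p.408 («the size M of big blocks»), bookkeeping] -/
theorem geo9K_M_eq (i : KIdx d ℓ hd hL b₀ b₁) : (geo9K i).M = ((ℓ : ℝ) + 1) * ((toKT i).Mh : ℝ) := by
  show (((ℓ + 1 : ℕ) : ℝ)) * (i.Mh : ℝ) = ((ℓ : ℝ) + 1) * ((i.Mh : ℕ) : ℝ)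
  push_cast; ring

/-! ## §2 ★★★ Family 2 of (3.105) as an ∃-threshold package at the member -/

/-- ★★★ **FAMILY 2 OF (3.105) AT THE MEMBER, ∃-THRESHOLD PACKAGE** (p. 414 (3.105) second sum `Σ_□(1 − ζ_□̃)DPD*h_□G_□h_□`, p. 411 «e^{−(1∕4)δ₀M}»).  For the
three block rates `δ_G, δ_X, δ_O > 0` and constants `B_G, B₁, B_O ≥ 0` of the letters `G′`, `(Q′G′²Q′*)⁻¹`, `O_□`, a real basis `b` with coordinate bound `M₂`, and
walk letters `Rr, Hp`, there are MEMBER-INDEPENDENT `ρ₂, κ₂ > 0`, `Θ₂ ≥ 0` and a threshold `M₀` such that for every member `i` with `M₀ ≤ L·M_h` and every background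
family through it carrying the three letters' blocks at those rates∕constants (displayed: `hE`, `hEO`, `hCinv`, bi-contractive transporters `hpar`, `η = |c_f|⁻¹`):
`Σ_□ conj b(((1 − M_{ζ_□̃})·DPD*(U₁)·(M_{h_□}O_□(U₁)M_{h_□}))^ℝ) ≺ Θ₂·e^{−κ₂M_h}·e^{−ρ₂d}` on the block carrier `(f, j) ↦ ιB(Δf₋)` — p33's Z2-P record
`hasMajorant_sum_famTwo_zetaY_closed` with its (2.61)s, scale transfers and rate budgets discharged (`ineq261_three_geo9K`, `scaleTransfer_len_geo9K` ∕ `_sq_` ∕ `_inv4_`,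
§1).  [cite: Balaban1985BackgroundPropagators, (3.105)–(3.106) p.414, p.411 l.36–41, Thm 3.10 p.416; Balaban1984PropagatorsII, Lemma 2.1 (2.60)–(2.61) p.234] -/
theorem famTwo_at_member [∀ i' : KIdx d ℓ hd hL b₀ b₁, Fintype (geo9K i').Site] [∀ i' : KIdx d ℓ hd hL b₀ b₁, DecidableEq (geo9K i').Site]
    (Rr : KIdx d ℓ hd hL b₀ b₁ → ℝ) (Hp : KIdx d ℓ hd hL b₀ b₁ → Prop) (b : Module.Basis ι ℝ 𝔸) {M₂ : ℝ} (hM₂ : 0 ≤ M₂)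
    {δG δX δO BG B₁ BO : ℝ} (hδG : 0 < δG) (hδX : 0 < δX) (hδO : 0 < δO) (hBG : 0 ≤ BG) (hB₁ : 0 ≤ B₁) (hBO : 0 ≤ BO) :
    ∃ ρ₂ κ₂ Θ₂ M₀ : ℝ, 0 < ρ₂ ∧ 0 < κ₂ ∧ 0 ≤ Θ₂ ∧
    ∀ (i : KIdx d ℓ hd hL b₀ b₁), M₀ ≤ ((ℓ : ℝ) + 1) * (toKT i).Mh →
    ∀ (hrepr : ∀ (v : 𝔸) (j : ι), |b.repr v j| ≤ M₂ * ‖v‖)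
      {B : B9.Backgrounds} (cfg : B.Cfg → CfgY 𝔸 i) (Gp : SiteOpY 𝔸 i) (parS : SiteParY 𝔸 i) (par : BondParY 𝔸 i) {U₁ : B.Cfg}
      (_ : EBlock (kernelFamilySInv i B cfg Gp parS) BG δG U₁)
      (Oc : ↥(cubes i.D.toDomains) → BondOpY 𝔸 i) (_ : ∀ c : ↥(cubes i.D.toDomains), EBlock (kernelFamilyBInv i B cfg (Oc c) par) BO δO U₁)
      (ιB : BlkY i → IBondY i) (_ : ∀ s, β i.hN i.D i.hk (ιB s) = s)
      (_ : ∀ z w : SiteY i, ‖(parS (cfg U₁) z w : 𝔸)‖ ≤ 1 ∧ ‖(((parS (cfg U₁) z w)⁻¹ : 𝔸ˣ) : 𝔸)‖ ≤ 1)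
      (_ : etaS i = |i.cf|⁻¹)
      (_ : HasMajorant (g := toB6 (geo9K i) (Rr i) (Hp i)) (fun q : BlkY i × ι => ιB q.1)
        (conj b (((etaS i ^ 2 * etaS i ^ 2)⁻¹) • (XinvY i parS Gp (cfg U₁)).restrictScalars ℝ))
        (fun a a' => B₁ * ((geo9K i).len a ^ 4)⁻¹ * Real.exp (-(δX * (geo9K i).dist a a')))),
    HasMajorant (g := toB6 (geo9K i) (Rr i) (Hp i)) (fun p : FBondY i × ι => ιB (blkV1 i.hN i.D p.1))
      (∑ c : ↥(cubes i.D.toDomains), conj b (((1 - cutMulY (𝔸 := 𝔸) (hBdY i (zetaY i c))) * DPDsY i parS Gp (cfg U₁) *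
        (cutMulY (𝔸 := 𝔸) (hBdY i (hTY i c)) * Oc c (cfg U₁) * cutMulY (𝔸 := 𝔸) (hBdY i (hTY i c)))).restrictScalars ℝ))
      (fun a a' => Θ₂ * Real.exp (-(κ₂ * ((toKT i).Mh : ℝ))) * Real.exp (-(ρ₂ * (geo9K i).dist a a'))) := by
  have hL1 : (1 : ℝ) ≤ (ℓ : ℝ) + 1 := by linarith [(Nat.cast_nonneg ℓ : (0 : ℝ) ≤ ℓ)]
  have hL0 : (0 : ℝ) < (ℓ : ℝ) + 1 := by positivity
  have hlog : 0 ≤ Real.log ((ℓ : ℝ) + 1) := Real.log_nonneg hL1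
  have h2L : (0 : ℝ) < 2 * ((ℓ : ℝ) + 1) ^ 2 - 1 := by nlinarith
  have hSb : 0 ≤ ∑ j, ‖b j‖ := Finset.sum_nonneg fun _ _ => norm_nonneg _
  have hS : 0 ≤ M₂ * ∑ j, ‖b j‖ := mul_nonneg hM₂ hSb
  -- the first rate group: `δ_P = min δ_G δ_X`, `δ₀ = δ_P`, `α = β = ¼`, `ρ_P = δ_P∕4`, `Λ = L⁴`
  set δP : ℝ := min δG δX with hδPdef
  have hδP : 0 < δP := lt_min hδG hδX
  have hδPG : δP ≤ δG := min_le_left _ _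
  have hδPX : δP ≤ δX := min_le_right _ _
  have hq : 0 < 1 / 4 * δP := by positivity
  -- the second rate group: `r = ρ_P∕δ_O`, `ρ = min (r∕3) ½`, `a_sep = α_st = r∕3`, `Λ′ = L²`
  set r : ℝ := δP / 4 / δO with hrdef
  have hr : 0 < r := by positivity
  set ρ : ℝ := min (r / 3) (1 / 2) with hρdef
  have hρ : 0 < ρ := lt_min (by positivity) (by norm_num)
  have hρ3 : ρ ≤ r / 3 := min_le_left _ _
  have hρ2 : ρ ≤ 1 / 2 := min_le_right _ _
  have h1ρ : 0 < (1 - ρ) * δO := by nlinarith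
  have hst : 0 < r / 3 * δO := by positivity
  have hst' : r / 3 * δO = δP / 12 := by rw [hrdef]; field_simp; ring
  -- the two (2.61) exponents above one threshold
  obtain ⟨ML, hgeo⟩ := ineq261_three_geo9K Rr Hp hq h1ρ h1ρ
  set dB : ℕ := exp261 (geo9K (d := d) (ℓ := ℓ) (hd := hd) (hL := hL) (b₀ := b₀) (b₁ := b₁)) δP (1 / 4) with hdBdef
  set dB' : ℕ := max (exp261 (geo9K (d := d) (ℓ := ℓ) (hd := hd) (hL := hL) (b₀ := b₀) (b₁ := b₁)) δO (1 - ρ))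
    (exp261 (geo9K (d := d) (ℓ := ℓ) (hd := hd) (hL := hL) (b₀ := b₀) (b₁ := b₁)) δO (1 - ρ)) with hdB'def
  have hc1 : 0 ≤ B6.c1 dB δP (1 / 4) := c1_nonneg _ _ _
  have hc1' : 0 ≤ B6.c1 dB' δO (1 - ρ) := c1_nonneg _ _ _
  -- the uniform constants
  set Θ₂ : ℝ := (3 * 5 ^ (d + 1)) *
    (kappa349 (M₂ * ∑ j, ‖b j‖) (((d : ℝ) + 1) * (M₂ * (∑ j, ‖b j‖) * BG)) B₁ (((ℓ : ℝ) + 1) ^ 4) (B6.c1 dB δP (1 / 4)) * (M₂ * (∑ j, ‖b j‖) * BO) *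
      ((ℓ : ℝ) + 1) ^ 2 * B6.c1 dB' δO (1 - ρ)) with hΘ₂def
  have hΘ₂ : 0 ≤ Θ₂ := by
    rw [hΘ₂def]
    have hk := kappa349_nonneg (κQ := M₂ * ∑ j, ‖b j‖) (B₀ := ((d : ℝ) + 1) * (M₂ * (∑ j, ‖b j‖) * BG)) (Λ := ((ℓ : ℝ) + 1) ^ 4)
      (c := B6.c1 dB δP (1 / 4)) hB₁
    positivity
  refine ⟨ρ * δO, r / 3 * δO / (2 * ((ℓ : ℝ) + 1)), Θ₂,
    max ML (max (4 * Real.log ((ℓ : ℝ) + 1) / (1 / 4 * δP * (2 * ((ℓ : ℝ) + 1) ^ 2 - 1)))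
      (2 * Real.log ((ℓ : ℝ) + 1) / (r / 3 * δO * (2 * ((ℓ : ℝ) + 1) ^ 2 - 1)))),
    by positivity, by positivity, hΘ₂, ?_⟩
  intro i hM hrepr B cfg Gp parS par U₁ hE Oc hEO ιB hι hpar hη hCinv
  -- thresholds
  have hMg : (geo9K i).M = ((ℓ : ℝ) + 1) * ((toKT i).Mh : ℝ) := geo9K_M_eq i
  have hML : ML ≤ (geo9K i).M := by rw [hMg]; exact (le_max_left _ _).trans hM
  have hM4 : 4 * Real.log ((ℓ : ℝ) + 1) / (1 / 4 * δP * (2 * ((ℓ : ℝ) + 1) ^ 2 - 1)) ≤ (geo9K i).M := by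
    rw [hMg]; exact ((le_max_left _ _).trans (le_max_right _ _)).trans hM
  have hM2' : 2 * Real.log ((ℓ : ℝ) + 1) / (r / 3 * δO * (2 * ((ℓ : ℝ) + 1) ^ 2 - 1)) ≤ (geo9K i).M := by
    rw [hMg]; exact ((le_max_right _ _).trans (le_max_right _ _)).trans hM
  have hden : 0 < 1 / 4 * δP * (2 * ((ℓ : ℝ) + 1) ^ 2 - 1) := by positivity
  have hden' : 0 < r / 3 * δO * (2 * ((ℓ : ℝ) + 1) ^ 2 - 1) := by positivity
  have hM4' : 4 * Real.log ((ℓ : ℝ) + 1) ≤ 1 / 4 * δP * (2 * ((ℓ : ℝ) + 1) ^ 2 - 1) * (geo9K i).M := by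
    rw [div_le_iff₀ hden] at hM4; linarith
  have hM1' : Real.log ((ℓ : ℝ) + 1) ≤ 1 / 4 * δP * (2 * ((ℓ : ℝ) + 1) ^ 2 - 1) * (geo9K i).M := by linarith
  have hM2'' : 2 * Real.log ((ℓ : ℝ) + 1) ≤ 1 / 4 * δP * (2 * ((ℓ : ℝ) + 1) ^ 2 - 1) * (geo9K i).M := by linarith
  have hMst : 2 * Real.log ((ℓ : ℝ) + 1) ≤ r / 3 * δO * (2 * ((ℓ : ℝ) + 1) ^ 2 - 1) * (geo9K i).M := by
    rw [div_le_iff₀ hden'] at hM2'; linarith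
  -- the member geometry: (2.61) twice, the four scale transfers
  obtain ⟨h261, h261', -⟩ := hgeo i hML
  have hl0 : ∀ a : (geo9K i).Site, 0 ≤ (geo9K i).len a := fun a => (geo9K_len_pos i a).le
  have hL4 : ((ℓ : ℝ) + 1) ≤ ((ℓ : ℝ) + 1) ^ 4 := by
    calc ((ℓ : ℝ) + 1) = ((ℓ : ℝ) + 1) ^ 1 := (pow_one _).symm
      _ ≤ ((ℓ : ℝ) + 1) ^ 4 := pow_le_pow_right₀ hL1 (by norm_num)
  have hL24 : ((ℓ : ℝ) + 1) ^ 2 ≤ ((ℓ : ℝ) + 1) ^ 4 := pow_le_pow_right₀ hL1 (by norm_num)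
  have hT1 : ScaleTransfer (geo9K i) δP (1 / 4) (((ℓ : ℝ) + 1) ^ 4) (fun a => (geo9K i).len a) :=
    scaleTransfer_mono_const hl0 hL4 (scaleTransfer_len_geo9K i hq hM1')
  have hT2 : ScaleTransfer (geo9K i) δP (1 / 4) (((ℓ : ℝ) + 1) ^ 4) (fun a => (geo9K i).len a ^ 2) :=
    scaleTransfer_mono_const (fun a => pow_nonneg (hl0 a) 2) hL24 (scaleTransfer_len_sq_geo9K i hq hM2'')
  have hT4 : ScaleTransfer (geo9K i) δP (1 / 4) (((ℓ : ℝ) + 1) ^ 4) (fun a => ((geo9K i).len a ^ 4)⁻¹) :=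
    scaleTransfer_len_inv4_geo9K i hq hM4'
  have hST : ScaleTransfer (geo9K i) δO (r / 3) (((ℓ : ℝ) + 1) ^ 2) (fun a => (geo9K i).len a ^ 2) :=
    scaleTransfer_len_sq_geo9K i hst hMst
  -- `η ≠ 0`, so `η⁴·s = 1` for `s = (η²η²)⁻¹`
  have hη0 : 0 < etaS i := B9Ineq349SiteComposite.etaS_pos i
  have hs : (etaS i ^ 2 * etaS i ^ 2) * (etaS i ^ 2 * etaS i ^ 2)⁻¹ = 1 := mul_inv_cancel₀ (by positivity)
  -- the record
  have hrec := hasMajorant_sum_famTwo_zetaY_closed i b cfg Gp parS par hE hBG Oc hBO hδO hEO ιB hι hpar hM₂ hrepr hη hs hB₁ (Rr i) (Hp i) hCinv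
    dB (le_trans hL1 hL4) (by positivity : (0 : ℝ) ≤ δP / 4) (by norm_num : (0 : ℝ) ≤ 1 / 4) (by norm_num : (0 : ℝ) ≤ 1 / 4) hδP.le hδPG hδPX
    (by linarith : δP / 4 + (2 * (1 / 4) + 1 / 4) * δP ≤ δP) h261 hT1 hT2 hT4
    dB' (by positivity : (0 : ℝ) ≤ ((ℓ : ℝ) + 1) ^ 2) (by positivity : (0 : ℝ) ≤ r / 3) hρ.le
    (by rw [hrdef] at hρ3 ⊢; linarith : r / 3 + r / 3 + ρ ≤ δP / 4 / δO) h261' hST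
  refine hasMajorant_mono (g := toB6 (geo9K i) (Rr i) (Hp i)) _ hrec fun a a' => le_of_eq ?_
  rw [exp_DsepT_eq i (r / 3) δO, hΘ₂def]
  ring
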